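import Literature.MathematicalPhysics.QuantumLattice.GaugeGroups
import HarnessLib

/-!
# Stub `stub_isSimpleCompactGroup_of_mulEquiv` (I4) of the line `Sketch` for the crux
# `NonSimplyConnectedLatticeGap` (stmt-QuantumFields-16405, route `ConvexGribovBody`)

Transport of the predicate `IsSimpleCompactGroup` along an isomorphism of topological groups,
i.e. a `MulEquiv` `e : G ≃* H` that is continuous in both directions:

* connectedness of `H` follows since `H = e '' univ` is the continuous image of a connected space;
* non-commutativity is transported by `e` (injective multiplicative map);
* for a closed preconnected normal subgroup `N ≤ H`, its preimage `M = N.comap e` is normal,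
  closed (preimage under the continuous `e`) and preconnected (it is the image of `N` under the
  continuous `e.symm`), so `M = ⊥ ∨ M = ⊤` in `G`, and this transports back to `N` because `e`
  is a bijection.

Elementary; no named facts are used.
-/

set_option autoImplicit false

namespace Summit.QuantumFields.YangMills.Theorems.NonSimplyConnectedLatticeGap

open Literature.MathematicalPhysics.QuantumLattice

/-- The preimage of a subset of `H` under a `MulEquiv` `e : G ≃* H` is its image under
`e.symm`. [folklore] -/
theorem isSimpleCompactGroup_transport_preimage_eq_image_symm
    {G H : Type} [Group G] [Group H] (e : G ≃* H) (s : Set H) :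
    (e : G → H) ⁻¹' s = (e.symm : H → G) '' s := by
  ext x
  constructor
  · intro hx
    exact ⟨e x, hx, e.symm_apply_apply x⟩
  · rintro ⟨y, hy, rfl⟩
    show e (e.symm y) ∈ s
    rwa [e.apply_symm_apply]

/-- A topological-group isomorphism (a `MulEquiv` continuous in both directions) transports the
predicate `IsSimpleCompactGroup`: connected, non-abelian, and every closed connected normal
subgroup trivial or everything. [folklore] -/
theorem stub_isSimpleCompactGroup_of_mulEquiv :
    ∀ (G H : Type) [Group G] [TopologicalSpace G] [Group H] [TopologicalSpace H] (e : G ≃* H),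
      Continuous e → Continuous e.symm →
      Literature.MathematicalPhysics.QuantumLattice.IsSimpleCompactGroup G →
      Literature.MathematicalPhysics.QuantumLattice.IsSimpleCompactGroup H := by
  intro G H _ _ _ _ e he hes hG
  obtain ⟨hconn, ⟨a, b, hab⟩, hN⟩ := hG
  refine ⟨?_, ⟨e a, e b, ?_⟩, fun N hNn hc hp => ?_⟩
  · -- connectedness: `H` is the continuous image of the connected space `G`
    haveI := hconn
    exact e.surjective.connectedSpace he
  · -- non-commutativity is transported by the injective hom `e`
    intro h
    apply hab
    apply e.injective
    rw [map_mul, map_mul, h]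
  · -- the normal-subgroup clause: pull `N` back to `G`, apply the clause there, push forward
    set M : Subgroup G := N.comap (e : G →* H)
    have hMn : M.Normal := Subgroup.Normal.comap hNn _
    have hMset : (M : Set G) = (e : G → H) ⁻¹' (N : Set H) := rfl
    have hMc : IsClosed (M : Set G) := by
      rw [hMset]
      exact hc.preimage he
    have hMp : IsPreconnected (M : Set G) := by
      rw [hMset, isSimpleCompactGroup_transport_preimage_eq_image_symm]
      exact hp.image _ hes.continuousOn
    rcases hN M hMn hMc hMp with hbot | htop
    · left
      rw [Subgroup.eq_bot_iff_forall] at hbot ⊢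
      intro y hy
      have hx : e.symm y ∈ M := by
        show (e : G →* H) (e.symm y) ∈ N
        simpa using hy
      have := hbot _ hx
      simpa using congrArg e this
    · right
      rw [Subgroup.eq_top_iff'] at htop ⊢
      intro y
      have hx : e.symm y ∈ M := htop _
      have : (e : G →* H) (e.symm y) ∈ N := hx
      simpa using this

end Summit.QuantumFields.YangMills.Theorems.NonSimplyConnectedLatticeGap
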